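import Summits.KontsevichZagierPeriods.KontsevichZagierPeriods.Theses.SymplecticScissors
import Summits.KontsevichZagierPeriods.KontsevichZagierPeriods.Theorems.SymplecticScissorsPlanarCompilerStubElementaryMovesAux
import Literature.NumberTheory.Transcendental.SemialgebraicLineDeriv
import Literature.NumberTheory.Transcendental.KZSemialgebraicComplex
import Literature.NumberTheory.Transcendental.KZDominatedFamilyRelations

/-!
# `PlanarCompiler`, stub `stub_elementaryMoves` — helper file III: rule 2 in dimension one

Crux stmt-KontsevichZagierPeriods-10058 (route SymplecticScissors), line `twist-restoring-shear`.

* `exists_push`: for `U` open in the line, `Φ : ℝ¹ → ℝ¹` `ℚ`-semialgebraic, injective and `C²` on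
  `U` with nowhere-vanishing derivative `Φ'`, and `F x = g (Φ x) · |Φ' x|` on `U`, the planar map
  `(x, y) ↦ (Φ x, y / |Φ' x|)` (`ℚ`-semialgebraic, injective, differentiable, `|det| = 1`) carries an
  integrand-`1` representation on the open subgraph `{x ∈ U, 0 < y < F x}` onto one on
  `{u ∈ Φ(U), 0 < v < g u}`, within the planar set-chain group `G`;
* `exists_good_open`: off a finite subset of `σ` the map `Φ` of a 1-dimensional rule-2 instance is
  `C^∞` with non-vanishing derivative (generic smoothness; the zero set of the derivative of an
  injective function has empty interior; null semialgebraic subsets of the line are finite);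
* `changeOfVariables_cells_mem_planarGroup`: for a 1-dimensional change-of-variables instance
  `(ρ, ρ', Φ, Φ')` and the honest planar cells of `f^±` over `σ` and of `f'^±` over `Φ(σ)`,
  `([s] − [t]) − ([s'] − [t'])` lies in `G` (push the cells over the good set, the rest is null);
  registered sub-goal `stub_elementaryMoves_rule2` (the same, `G` written out).
-/

noncomputable section

open MeasureTheory Set
open Literature.NumberTheory.Transcendental Literature.ModelTheory.ExponentialFields
open Summit.KontsevichZagierPeriods.KontsevichZagierPeriods.Theses.SymplecticScissors
open Summit.KontsevichZagierPeriods.SymplecticScissors.PlanarK0InjectiveNegative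

namespace Summit.KontsevichZagierPeriods.SymplecticScissors.PlanarCompilerProof.ElementaryMoves

/-- **Pushing cells forward along a map of the line is a planar rule-2 instance.** See the module
docstring. [Kontsevich–Zagier 2001, §1.2, rule (2)] -/
theorem exists_push {U : Set (Fin 1 → ℝ)} (hUo : IsOpen U) (hUs : IsSemialgebraic ℚ U)
    {Φ : (Fin 1 → ℝ) → (Fin 1 → ℝ)} (hΦ : IsSemialgebraicMapOn ℚ U Φ)
    (hΦc : ContDiffOn ℝ 2 (fun x => Φ x 0) U) (hinjΦ : InjOn Φ U)
    (hd0 : ∀ x ∈ U, fderiv ℝ (fun x => Φ x 0) x (Pi.single 0 1) ≠ 0)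
    {F g : (Fin 1 → ℝ) → ℝ}
    (hFg : ∀ x ∈ U, F x = g (Φ x) * |fderiv ℝ (fun x => Φ x 0) x (Pi.single 0 1)|)
    (r : KZ.IntegralRep 2) (hr : ∀ p ∈ r.domain, r.integrand p = 1)
    (hrd : r.domain = {p : Fin 2 → ℝ | (fun _ : Fin 1 => p 0) ∈ U ∧ 0 < p 1 ∧
      p 1 < F (fun _ : Fin 1 => p 0)}) :
    ∃ r' : KZ.IntegralRep 2, r'.domain = {q : Fin 2 → ℝ | (fun _ : Fin 1 => q 0) ∈ Φ '' U ∧ 0 < q 1 ∧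
      q 1 < g (fun _ : Fin 1 => q 0)} ∧ (r'.integrand = fun _ => 1) ∧
      KZ.of r - KZ.of r' ∈ planarGroup := by
  -- the scalar map, its derivative and the vertical scaling factor
  set φ : (Fin 1 → ℝ) → ℝ := fun x => Φ x 0 with hφ
  set d : (Fin 1 → ℝ) → ℝ := fun x => fderiv ℝ φ x (Pi.single 0 1) with hd
  set k : (Fin 1 → ℝ) → ℝ := fun x => |d x|⁻¹ with hk
  have hΦφ : ∀ x, Φ x = fun _ : Fin 1 => φ x := fun x => KZ.eq_const_apply_zero (Φ x)
  have hφdiff : ∀ x ∈ U, DifferentiableAt ℝ φ x := fun x hx =>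
    ((hΦc.differentiableOn (by norm_num)) x hx).differentiableAt (hUo.mem_nhds hx)
  have hdiffd : DifferentiableOn ℝ d U := by
    have h1 : ContDiffOn ℝ 1 (fderiv ℝ φ) U := hΦc.fderiv_of_isOpen hUo (by norm_num)
    exact (h1.differentiableOn (by norm_num)).clm_apply (differentiableOn_const _)
  have hdpos : ∀ x ∈ U, 0 < |d x| := fun x hx => abs_pos.mpr (hd0 x hx)
  have hkdiff : ∀ x ∈ U, DifferentiableAt ℝ k x := fun x hx =>
    (((hdiffd x hx).differentiableAt (hUo.mem_nhds hx)).abs (hd0 x hx)).inv (hdpos x hx).ne'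
  have hkpos : ∀ x ∈ U, 0 < k x := fun x hx => inv_pos.mpr (hdpos x hx)
  -- semialgebraicity of `φ`, `d`, `k`
  have hφs : IsSemialgebraicFunOn ℚ U φ := (isSemialgebraicMapOn_iff_forall_holds hUs).mp hΦ 0
  have hds : IsSemialgebraicFunOn ℚ U d := hφs.fderiv_apply_single hUo hφdiff 0
  have hks : IsSemialgebraicFunOn ℚ U k := (hds.abs).inv fun x hx => (hdpos x hx).ne'
  -- the planar map
  have hdomS : IsSemialgebraic ℚ r.domain := r.isSemialgebraic_domain
  have hsub : r.domain ⊆ {p : Fin 2 → ℝ | (fun _ : Fin 1 => p 0) ∈ U} := by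
    rw [hrd]; exact fun p hp => hp.1
  let bL : (Fin 2 → ℝ) →L[ℝ] (Fin 1 → ℝ) :=
    ContinuousLinearMap.pi fun _ : Fin 1 => ContinuousLinearMap.proj (0 : Fin 2)
  have hbL : ∀ p : Fin 2 → ℝ, bL p = fun _ : Fin 1 => p 0 := fun p => rfl
  set Ψ : (Fin 2 → ℝ) → (Fin 2 → ℝ) := fun p =>
    ![φ (fun _ : Fin 1 => p 0), p 1 * k (fun _ : Fin 1 => p 0)] with hΨ
  let L₀ : (Fin 2 → ℝ) → (Fin 2 → ℝ) →L[ℝ] ℝ := fun p => (fderiv ℝ φ (fun _ : Fin 1 => p 0)).comp bL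
  let L₁ : (Fin 2 → ℝ) → (Fin 2 → ℝ) →L[ℝ] ℝ := fun p =>
    (p 1) • (fderiv ℝ k (fun _ : Fin 1 => p 0)).comp bL +
      k (fun _ : Fin 1 => p 0) • ContinuousLinearMap.proj (R := ℝ) (φ := fun _ : Fin 2 => ℝ) (1 : Fin 2)
  let Ψ' : (Fin 2 → ℝ) → (Fin 2 → ℝ) →L[ℝ] (Fin 2 → ℝ) := fun p =>
    (L₀ p).smulRight (Pi.single 0 1) + (L₁ p).smulRight (Pi.single 1 1)
  have hΨ' : ∀ p w : Fin 2 → ℝ, Ψ' p w =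
      ![fderiv ℝ φ (fun _ : Fin 1 => p 0) (fun _ : Fin 1 => w 0),
        p 1 * fderiv ℝ k (fun _ : Fin 1 => p 0) (fun _ : Fin 1 => w 0) + k (fun _ : Fin 1 => p 0) * w 1] := by
    intro p w
    funext i
    fin_cases i <;> simp [Ψ', L₀, L₁, hbL]
  -- determinant
  have hkey : ∀ x ∈ U, |fderiv ℝ φ x (Pi.single 0 1) * k x| = 1 := by
    intro x hx
    rw [hk]
    dsimp only
    rw [hd]
    dsimp only
    rw [abs_mul, abs_inv, abs_abs, mul_inv_cancel₀ (abs_pos.mpr (hd0 x hx)).ne']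
  have hdet : ∀ p : Fin 2 → ℝ, (fun _ : Fin 1 => p 0) ∈ U → |(Ψ' p).det| = 1 := by
    intro p hp
    have h := LinearMap.det_toMatrix' (Ψ' p : (Fin 2 → ℝ) →ₗ[ℝ] (Fin 2 → ℝ))
    rw [Matrix.det_fin_two] at h
    simp only [LinearMap.toMatrix'_apply, ContinuousLinearMap.coe_coe, hΨ'] at h
    show |LinearMap.det (Ψ' p : (Fin 2 → ℝ) →ₗ[ℝ] (Fin 2 → ℝ))| = 1
    rw [← h]
    have h0 : (fun _ : Fin 1 => (Pi.single (1 : Fin 2) (1 : ℝ) : Fin 2 → ℝ) 0) = 0 := by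
      funext i; simp
    simp only [h0, map_zero, mul_zero, zero_add, Matrix.cons_val_zero, Matrix.cons_val_one,
      Matrix.cons_val_fin_one, Pi.single_eq_same, mul_one,
      Pi.single_eq_of_ne (show (1 : Fin 2) ≠ 0 by decide), zero_mul, sub_zero]
    rw [← single_eq_one]
    exact hkey _ hp
  -- derivative
  have hderiv : ∀ p : Fin 2 → ℝ, (fun _ : Fin 1 => p 0) ∈ U → HasFDerivAt Ψ (Ψ' p) p := by
    intro p hp
    have hb : HasFDerivAt (fun x : Fin 2 → ℝ => (fun _ : Fin 1 => x 0)) bL p := bL.hasFDerivAt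
    rw [hasFDerivAt_pi']
    intro i
    fin_cases i
    · have hcomp := (hφdiff _ hp).hasFDerivAt.comp p hb
      have hfun : (fun x => Ψ x 0) = φ ∘ fun x : Fin 2 → ℝ => (fun _ : Fin 1 => x 0) := by
        funext x; simp [hΨ]
      show HasFDerivAt (fun x => Ψ x 0) _ p
      rw [hfun]
      refine hcomp.congr_fderiv (ContinuousLinearMap.ext fun w => ?_)
      simp [hΨ', hbL]
    · have hcomp := (hkdiff _ hp).hasFDerivAt.comp p hb
      have h1 : HasFDerivAt (fun x : Fin 2 → ℝ => x 1)
          (ContinuousLinearMap.proj (R := ℝ) (φ := fun _ : Fin 2 => ℝ) (1 : Fin 2)) p :=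
        hasFDerivAt_apply (1 : Fin 2) p
      have h := h1.mul hcomp
      have hfun : (fun x => Ψ x 1) =
          (fun x : Fin 2 → ℝ => x 1) * (k ∘ fun x : Fin 2 → ℝ => (fun _ : Fin 1 => x 0)) := by
        funext x; simp [hΨ]
      show HasFDerivAt (fun x => Ψ x 1) _ p
      rw [hfun]
      refine h.congr_fderiv (ContinuousLinearMap.ext fun w => ?_)
      simp [hΨ', hbL]
  -- semialgebraicity
  have hmap : IsSemialgebraicMapOn ℚ r.domain Ψ := by
    refine IsSemialgebraicMapOn.of_forall hdomS fun j => ?_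
    fin_cases j
    · exact (isSemialgebraicFunOn_base hφs hdomS hsub).congr fun p _ => by simp [hΨ]
    · exact (IsSemialgebraicFunOn.mul_holds (isSemialgebraicFunOn_apply hdomS (1 : Fin 2))
        (isSemialgebraicFunOn_base hks hdomS hsub)).congr fun p _ => by simp [hΨ]
  -- injectivity
  have hinj : InjOn Ψ r.domain := by
    intro p hp q hq hpq
    have hpU := hsub hp
    have hqU := hsub hq
    have h0 : φ (fun _ : Fin 1 => p 0) = φ (fun _ : Fin 1 => q 0) := by
      have := congr_fun hpq 0
      simpa [hΨ] using this
    have hx : (fun _ : Fin 1 => p 0) = (fun _ : Fin 1 => q 0) := by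
      refine hinjΦ hpU hqU ?_
      rw [hΦφ, hΦφ (fun _ : Fin 1 => q 0), h0]
    have hp0 : p 0 = q 0 := congr_fun hx 0
    have h1 : p 1 * k (fun _ : Fin 1 => p 0) = q 1 * k (fun _ : Fin 1 => q 0) := by
      have := congr_fun hpq 1
      simpa [hΨ] using this
    rw [hx] at h1
    have hp1 : p 1 = q 1 := mul_right_cancel₀ (hkpos _ hqU).ne' h1
    rw [eq_vec p, eq_vec q, hp0, hp1]
  -- image
  have himage : Ψ '' r.domain = {q : Fin 2 → ℝ | (fun _ : Fin 1 => q 0) ∈ Φ '' U ∧ 0 < q 1 ∧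
      q 1 < g (fun _ : Fin 1 => q 0)} := by
    rw [hrd]
    ext q
    simp only [mem_image, mem_setOf_eq]
    constructor
    · rintro ⟨p, ⟨hpU, hp1, hp2⟩, rfl⟩
      have hkx := hkpos _ hpU
      have hdx := hdpos _ hpU
      simp only [hΨ, Matrix.cons_val_zero, Matrix.cons_val_one, Matrix.cons_val_fin_one]
      refine ⟨⟨_, hpU, hΦφ _⟩, mul_pos hp1 hkx, ?_⟩
      rw [hFg _ hpU, hΦφ] at hp2
      rw [hk]
      simp only
      rw [← div_eq_mul_inv, div_lt_iff₀ hdx]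
      exact hp2
    · rintro ⟨⟨x, hxU, hxq⟩, hq1, hq2⟩
      have hx0 : x = fun _ : Fin 1 => x 0 := KZ.eq_const_apply_zero x
      have hkx := hkpos _ hxU
      have hdx := hdpos _ hxU
      have hφx : φ x = q 0 := by
        have := congr_fun hxq 0
        simpa [hφ] using this
      refine ⟨![x 0, q 1 * |d x|], ⟨?_, ?_, ?_⟩, ?_⟩
      · simpa [← hx0] using hxU
      · simpa using mul_pos hq1 hdx
      · simp only [Matrix.cons_val_zero, Matrix.cons_val_one, Matrix.cons_val_fin_one, ← hx0]
        rw [hFg _ hxU, hxq]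
        exact mul_lt_mul_of_pos_right hq2 hdx
      · simp only [hΨ, Matrix.cons_val_zero, Matrix.cons_val_one, Matrix.cons_val_fin_one, ← hx0,
          hk, mul_assoc, mul_inv_cancel₀ hdx.ne', mul_one, hφx]
        exact (eq_vec q).symm
  have hdv : ∀ p ∈ r.domain, HasFDerivWithinAt Ψ (Ψ' p) r.domain p :=
    fun p hp => (hderiv p (hsub hp)).hasFDerivWithinAt
  have hdet' : ∀ p ∈ r.domain, |(Ψ' p).det| = 1 := fun p hp => hdet p (hsub hp)
  obtain ⟨r', hr'd, hr'i⟩ := exists_rep_image r hr hmap hdv hinj hdet'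
  have hr'1 : ∀ p ∈ r'.domain, r'.integrand p = 1 := fun p _ => by rw [hr'i]
  exact ⟨r', hr'd.trans himage, hr'i,
    sub_mem_planarGroup_of_map r r' hr hr'1 hmap hdv hinj hdet' hr'd⟩

/-- **The good open set of a 1-dimensional change of variables.** For `Φ` `ℚ`-semialgebraic and
injective on a `ℚ`-semialgebraic `σ ⊆ ℝ¹` there is an open `ℚ`-semialgebraic `U ⊆ σ` with
`σ \ U` finite on which `x ↦ Φ x 0` is `C^∞` with nowhere-vanishing derivative (generic smoothness;
the zero set of the derivative has empty interior by injectivity and the mean value theorem; null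
semialgebraic subsets of the line are finite). [Bochnak–Coste–Roy 1998, §2.9] -/
theorem exists_good_open (σ : Set (Fin 1 → ℝ)) (hσ : IsSemialgebraic ℚ σ)
    (Φ : (Fin 1 → ℝ) → (Fin 1 → ℝ)) (hΦ : IsSemialgebraicMapOn ℚ σ Φ) (hinj : InjOn Φ σ) :
    ∃ U : Set (Fin 1 → ℝ), U ⊆ σ ∧ IsOpen U ∧ IsSemialgebraic ℚ U ∧
      ContDiffOn ℝ 2 (fun x => Φ x 0) U ∧
      (∀ x ∈ U, fderiv ℝ (fun x => Φ x 0) x (Pi.single 0 1) ≠ 0) ∧ (σ \ U).Finite := by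
  set φ : (Fin 1 → ℝ) → ℝ := fun x => Φ x 0 with hφ
  have hΦφ : ∀ x, Φ x = fun _ : Fin 1 => φ x := fun x => KZ.eq_const_apply_zero (Φ x)
  have hφs : IsSemialgebraicFunOn ℚ σ φ := (isSemialgebraicMapOn_iff_forall_holds hσ).mp hΦ 0
  obtain ⟨U₁, hU₁σ, hU₁o, hU₁s, hU₁c, -, hU₁0⟩ := KZ.exists_isOpen_contDiffOn hσ hφs
  set d : (Fin 1 → ℝ) → ℝ := fun x => fderiv ℝ φ x (Pi.single 0 1) with hd
  have hφdiff : ∀ x ∈ U₁, DifferentiableAt ℝ φ x := fun x hx =>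
    ((hU₁c.differentiableOn (by simp)) x hx).differentiableAt (hU₁o.mem_nhds hx)
  have hds : IsSemialgebraicFunOn ℚ U₁ d := (hφs.mono hU₁σ hU₁s).fderiv_apply_single hU₁o hφdiff 0
  have hdc : ContinuousOn d U₁ :=
    (hU₁c.continuousOn_fderiv_of_isOpen hU₁o (by simp)).clm_apply continuousOn_const
  -- the zero set of the derivative
  have hZ : IsSemialgebraic ℚ {x | x ∈ U₁ ∧ d x = (fun _ => (0 : ℝ)) x} :=
    isSemialgebraic_sep_eq hds ((isSemialgebraicFunOn_aeval hU₁s 0).congr fun x _ => by simp)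
  set Z := {x | x ∈ U₁ ∧ d x = (fun _ => (0 : ℝ)) x} with hZ_def
  have hZint : interior Z = ∅ := by
    by_contra hne
    obtain ⟨x₀, hx₀⟩ := nonempty_iff_ne_empty.mpr hne
    obtain ⟨ε, hε, hball⟩ := Metric.isOpen_iff.mp isOpen_interior x₀ hx₀
    have hBZ : Metric.ball x₀ ε ⊆ Z := hball.trans interior_subset
    have hBU : Metric.ball x₀ ε ⊆ U₁ := fun x hx => (hBZ hx).1
    have hfd : ∀ x ∈ Metric.ball x₀ ε, fderiv ℝ φ x = 0 := by
      intro x hx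
      refine ContinuousLinearMap.ext fun w => ?_
      have hw : w = w 0 • (Pi.single (0 : Fin 1) (1 : ℝ) : Fin 1 → ℝ) := by
        rw [single_eq_one]
        funext i
        rw [Fin.eq_zero i]
        simp
      have h0 : fderiv ℝ φ x (Pi.single 0 1) = 0 := (hBZ hx).2
      rw [hw, map_smul, h0, smul_zero]
      rfl
    set y : Fin 1 → ℝ := x₀ + fun _ => ε / 2 with hy
    have hyB : y ∈ Metric.ball x₀ ε := by
      rw [Metric.mem_ball, dist_eq_norm, hy, add_sub_cancel_left, pi_norm_const, Real.norm_eq_abs,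
        abs_of_pos (half_pos hε)]
      exact half_lt_self hε
    have hx₀B : x₀ ∈ Metric.ball x₀ ε := Metric.mem_ball_self hε
    have hconst : φ x₀ = φ y := (Metric.isOpen_ball).is_const_of_fderiv_eq_zero
      (convex_ball x₀ ε).isPreconnected (fun x hx => (hφdiff x (hBU hx)).differentiableWithinAt) hfd
      hx₀B hyB
    have hΦeq : Φ x₀ = Φ y := by rw [hΦφ, hΦφ y, hconst]
    have := hinj (hU₁σ (hBU hx₀B)) (hU₁σ (hBU hyB)) hΦeq
    have h0 : (x₀ : Fin 1 → ℝ) 0 = y 0 := by rw [← this]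
    rw [hy] at h0
    simp only [Pi.add_apply] at h0
    linarith
  have hZ0 : volume Z = 0 := KZ.volume_eq_zero_of_interior_eq_empty hZ hZint
  -- the good set
  refine ⟨U₁ \ Z, fun x hx => hU₁σ hx.1, ?_, hU₁s.diff hZ, (hU₁c.of_le (by norm_cast)).mono Set.sdiff_subset,
    fun x hx h0 => hx.2 ⟨hx.1, h0⟩, ?_⟩
  · have : U₁ \ Z = U₁ ∩ d ⁻¹' {0}ᶜ := by
      ext x
      simp only [hZ_def, Set.mem_sdiff, mem_setOf_eq, mem_inter_iff, mem_preimage, mem_compl_iff,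
        mem_singleton_iff, not_and]
      exact ⟨fun h => ⟨h.1, h.2 h.1⟩, fun h => ⟨h.1, fun _ => h.2⟩⟩
    rw [this]
    exact hdc.isOpen_inter_preimage hU₁o isOpen_compl_singleton
  · refine finite_of_volume_eq_zero (hσ.diff (hU₁s.diff hZ)) (measure_mono_null ?_ (measure_union_null hU₁0 hZ0))
    intro x hx
    by_cases h : x ∈ U₁
    · exact Or.inr (by_contra fun hz => hx.2 ⟨h, hz⟩)
    · exact Or.inl ⟨hx.1, h⟩

/-- **Rule 2 in dimension one is killed by the cell compiler.** See the module docstring.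
[Kontsevich–Zagier 2001, §1.2, rules (1), (2)] -/
theorem changeOfVariables_cells_mem_planarGroup (ρ ρ' : KZ.IntegralRep 1)
    (Φ : (Fin 1 → ℝ) → (Fin 1 → ℝ)) (Φ' : (Fin 1 → ℝ) → (Fin 1 → ℝ) →L[ℝ] (Fin 1 → ℝ))
    (hΦ : IsSemialgebraicMapOn ℚ ρ.domain Φ)
    (hΦ' : ∀ x ∈ ρ.domain, HasFDerivWithinAt Φ (Φ' x) ρ.domain x)
    (hinj : InjOn Φ ρ.domain) (hdom : ρ'.domain = Φ '' ρ.domain)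
    (hint : ∀ x ∈ ρ.domain, ρ.integrand x = ρ'.integrand (Φ x) * |(Φ' x).det|)
    (s t s' t' : KZ.IntegralRep 2)
    (hsd : s.domain = {p : Fin 2 → ℝ | (fun _ : Fin 1 => p 0) ∈ ρ.domain ∧ 0 < p 1 ∧
      p 1 < ρ.integrand (fun _ : Fin 1 => p 0)})
    (htd : t.domain = {p : Fin 2 → ℝ | (fun _ : Fin 1 => p 0) ∈ ρ.domain ∧ 0 < p 1 ∧
      p 1 < -ρ.integrand (fun _ : Fin 1 => p 0)})
    (hs'd : s'.domain = {p : Fin 2 → ℝ | (fun _ : Fin 1 => p 0) ∈ ρ'.domain ∧ 0 < p 1 ∧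
      p 1 < ρ'.integrand (fun _ : Fin 1 => p 0)})
    (ht'd : t'.domain = {p : Fin 2 → ℝ | (fun _ : Fin 1 => p 0) ∈ ρ'.domain ∧ 0 < p 1 ∧
      p 1 < -ρ'.integrand (fun _ : Fin 1 => p 0)})
    (hs : ∀ p ∈ s.domain, s.integrand p = 1) (ht : ∀ p ∈ t.domain, t.integrand p = 1)
    (hs' : ∀ p ∈ s'.domain, s'.integrand p = 1) (ht' : ∀ p ∈ t'.domain, t'.integrand p = 1) :
    (KZ.of s - KZ.of t) - (KZ.of s' - KZ.of t') ∈ planarGroup := by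
  set σ := ρ.domain with hσ_def
  set f := ρ.integrand with hf_def
  set f' := ρ'.integrand with hf'_def
  have hσ : IsSemialgebraic ℚ σ := ρ.isSemialgebraic_domain
  obtain ⟨U, hUσ, hUo, hUs, hφc, hd0, hEfin⟩ := exists_good_open σ hσ Φ hΦ hinj
  have hU0 : volume (σ \ U) = 0 := hEfin.measure_zero _
  -- the derivative within `σ` at points of `U` is the derivative
  have hdet : ∀ x ∈ U, |(Φ' x).det| = |fderiv ℝ (fun x => Φ x 0) x (Pi.single 0 1)| := by
    intro x hx
    have h1 : HasFDerivAt Φ (Φ' x) x :=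
      (hΦ' x (hUσ hx)).hasFDerivAt (Filter.mem_of_superset (hUo.mem_nhds hx) hUσ)
    have h2 : HasFDerivAt (fun x => Φ x 0)
        ((ContinuousLinearMap.proj (R := ℝ) (φ := fun _ : Fin 1 => ℝ) (0 : Fin 1)).comp (Φ' x)) x :=
      (hasFDerivAt_pi'.mp h1) 0
    rw [h2.fderiv, det_eq_apply]
    rfl
  have hFg : ∀ x ∈ U, f x = f' (Φ x) * |fderiv ℝ (fun x => Φ x 0) x (Pi.single 0 1)| :=
    fun x hx => by rw [← hdet x hx]; exact hint x (hUσ hx)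
  have hFg' : ∀ x ∈ U, (fun x => -f x) x = (fun y => -f' y) (Φ x) * |fderiv ℝ (fun x => Φ x 0) x (Pi.single 0 1)| :=
    fun x hx => by simp only [hFg x hx, neg_mul]
  have hΦU : IsSemialgebraicMapOn ℚ U Φ := hΦ.mono hUσ hUs
  have hinjU : InjOn Φ U := hinj.mono hUσ
  -- restrict to `U` and push forward
  obtain ⟨sU, hsUd, hsU, esU⟩ := exists_restrict_cell s hs hsd hUs hUσ hU0
  obtain ⟨tU, htUd, htU, etU⟩ := exists_restrict_cell t ht (f := fun x => -f x) htd hUs hUσ hU0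
  obtain ⟨s'U, hs'Ud, hs'Ui, es⟩ := exists_push hUo hUs hΦU hφc hinjU hd0 hFg sU hsU hsUd
  obtain ⟨t'U, ht'Ud, ht'Ui, et⟩ := exists_push hUo hUs hΦU hφc hinjU hd0 (F := fun x => -f x)
    (g := fun y => -f' y) hFg' tU htU htUd
  have hs'U : ∀ p ∈ s'U.domain, s'U.integrand p = 1 := fun p _ => by rw [hs'Ui]
  have ht'U : ∀ p ∈ t'U.domain, t'U.integrand p = 1 := fun p _ => by rw [ht'Ui]
  -- the image side: cells over `Φ(σ) \ Φ(U) ⊆ Φ(σ \ U)` are null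
  have himE : volume (Φ '' σ \ Φ '' U) = 0 := by
    refine measure_mono_null ?_ ((hEfin.image Φ).measure_zero _)
    rintro y ⟨⟨x, hx, hxy⟩, hy⟩
    exact ⟨x, ⟨hx, fun hxU => hy ⟨x, hxU, hxy⟩⟩, hxy⟩
  have es' : KZ.of s' - KZ.of s'U ∈ planarGroup := by
    refine sub_mem_planarGroup_of_subset s' s'U hs' hs'U ?_ (volume_eq_zero_of_base himE ?_)
    · rw [hs'd, hs'Ud, hdom]
      rintro q ⟨hq, h1, h2⟩
      exact ⟨image_mono hUσ hq, h1, h2⟩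
    · rw [hs'd, hs'Ud, hdom]
      rintro q ⟨⟨hq, h1, h2⟩, hq'⟩
      exact ⟨hq, fun hqU => hq' ⟨hqU, h1, h2⟩⟩
  have et' : KZ.of t' - KZ.of t'U ∈ planarGroup := by
    refine sub_mem_planarGroup_of_subset t' t'U ht' ht'U ?_ (volume_eq_zero_of_base himE ?_)
    · rw [ht'd, ht'Ud, hdom]
      rintro q ⟨hq, h1, h2⟩
      exact ⟨image_mono hUσ hq, h1, h2⟩
    · rw [ht'd, ht'Ud, hdom]
      rintro q ⟨⟨hq, h1, h2⟩, hq'⟩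
      exact ⟨hq, fun hqU => hq' ⟨hqU, h1, h2⟩⟩
  have : (KZ.of s - KZ.of t) - (KZ.of s' - KZ.of t') =
      ((KZ.of s - KZ.of sU) + (KZ.of sU - KZ.of s'U) - (KZ.of s' - KZ.of s'U)) -
      ((KZ.of t - KZ.of tU) + (KZ.of tU - KZ.of t'U) - (KZ.of t' - KZ.of t'U)) := by abel
  rw [this]
  exact sub_mem (sub_mem (add_mem esU es) es') (sub_mem (add_mem etU et) et')

end Summit.KontsevichZagierPeriods.SymplecticScissors.PlanarCompilerProof.ElementaryMoves

namespace Summit.KontsevichZagierPeriods.SymplecticScissors.PlanarCompilerProof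

/-- **Registered sub-goal of `stub_elementaryMoves` (file III): rule 2 in dimension one.** For a
1-dimensional change-of-variables instance `(ρ, ρ', Φ, Φ')` and integrand-`1` planar
representations on the open subgraphs of `f, −f` over `σ` and of `f', −f'` over `Φ(σ)`,
`([s] − [t]) − ([s'] − [t'])` lies in the planar set-chain group. [Kontsevich–Zagier 2001, §1.2, rules (1), (2)] -/
theorem stub_elementaryMoves_rule2 : ∀ (ρ ρ' : KZ.IntegralRep 1) (Φ : (Fin 1 → ℝ) → (Fin 1 → ℝ)) (Φ' : (Fin 1 → ℝ) → (Fin 1 → ℝ) →L[ℝ] (Fin 1 → ℝ)), IsSemialgebraicMapOn ℚ ρ.domain Φ → (∀ x ∈ ρ.domain, HasFDerivWithinAt Φ (Φ' x) ρ.domain x) → Set.InjOn Φ ρ.domain → ρ'.domain = Φ '' ρ.domain → (∀ x ∈ ρ.domain, ρ.integrand x = ρ'.integrand (Φ x) * |(Φ' x).det|) → ∀ (s t s' t' : KZ.IntegralRep 2), s.domain = {p : Fin 2 → ℝ | (fun _ : Fin 1 => p 0) ∈ ρ.domain ∧ 0 < p 1 ∧ p 1 < ρ.integrand (fun _ : Fin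 1 => p 0)} → t.domain = {p : Fin 2 → ℝ | (fun _ : Fin 1 => p 0) ∈ ρ.domain ∧ 0 < p 1 ∧ p 1 < -ρ.integrand (fun _ : Fin 1 => p 0)} → s'.domain = {p : Fin 2 → ℝ | (fun _ : Fin 1 => p 0) ∈ ρ'.domain ∧ 0 < p 1 ∧ p 1 < ρ'.integrand (fun _ : Fin 1 => p 0)} → t'.domain = {p : Fin 2 → ℝ | (fun _ : Fin 1 => p 0) ∈ ρ'.domain ∧ 0 < p 1 ∧ p 1 < -ρ'.integrand (fun _ : Fin 1 => p 0)} → (∀ p ∈ s.domain, s.integrand p = 1) → (∀ p ∈ t.domain, t.integrand p = 1) → (∀ p ∈ s'.domain, s'.integrand p = 1) → (∀ p ∈ t'.domain, t'.integrand p = 1) → (KZ.of s - KZ.of t) - (KZ.of s' - KZ.of t') ∈ AddSubgroup.closure ((KZ.domainAddRel ∪ KZ.changeOfVariablesRel) ∩ (AddSubgroup.closure {x : KZ.FormalRep | ∃ s : KZ.IntegralRep 2, (∀ p ∈ s.domain, s.integrand p = 1) ∧ x = KZ.of s} : Set KZ.FormalRep)) :=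
  fun ρ ρ' Φ Φ' hΦ hΦ' hinj hdom hint s t s' t' hsd htd hs'd ht'd hs ht hs' ht' =>
    ElementaryMoves.changeOfVariables_cells_mem_planarGroup ρ ρ' Φ Φ' hΦ hΦ' hinj hdom hint s t s' t' hsd htd
      hs'd ht'd hs ht hs' ht'

end Summit.KontsevichZagierPeriods.SymplecticScissors.PlanarCompilerProof
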